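/-
Copyright (c) 2026 the pub-hodgecm-mathlib formalisation cell (harness21).  Prover seat hodgecm-mathlib-LH4-p09 (g8), req620 Track A «(D-RAM) FOUR-FRAME» squad
(heir LEAD F0P3a-plan (g20) T19-24 «STAGE-1b PRE-SCOPING BY IDLE HANDS: ALLOWED AS SCOPING»; dealer LH4-plan (g12)).  2026-09-04.
-/
import Summits.HodgeConjecture.HodgeConjecture.Theorems.F0P3cDyRamDiagonalSplitCountSockets   -- ★ B4 (LH4-p13 (g2)): `hasAxis_axis{1,2,3}_iff`, `finsum_stabiliserWeight_hasAxis_{core,T1,T2,T3}`; brings ★ StrataDefs `stratum`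
import Summits.HodgeConjecture.HodgeConjecture.Theorems.F0P3cDyRamLevelTokenHNF               -- ★ p859056 (this seat): `latticeInLevel_diagonal_latt_hnf_iff` (the diagonal level token on an HNF lattice)
import HarnessLib

/-!
# Crux `H413`, line LH4 «(D-RAM) FOUR-FRAME» road — STAGE-1b SCOPING BRICK «(L-model-T)»: THE LABELLED SPLIT STRATA — on the core and the three on-branch strata of ★ B4 a
# diagonal level token is CONSTANT, so the label-cut Stage-B contribution of these four strata is the ★ unit table behind an explicit inequality in the level and the axis

Cell `hodgecm-mathlib` (D-0151), FLOOR 0, crux item H413 = `stmt-HodgeConjecture-24833`, route of record `HCCMUnconditional`; squad F0∕P3c∕LH4 (req618∕req620).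
THEOREMS ONLY (no `def`, no instance, no notation, no `sorry`, default heartbeats); lane `--supports stmt-HodgeConjecture-24833 --as helper` (count-neutral).
Consumers: the producers of the labelled Stage-B tables of the STAGE-1b type-(1) level laws ((F2) `sq_{m*}`, (F3) `lev_{ℓ₀+1,m*}` of F0P3a-p01 (g35)'s SIGSHEET-1b draft).  By ★ p858861
∕ p858900 (this seat) such a law is a closed form for `Σᶠ_{M₀ ∈ 𝓛₀(diag(α,β,1)), label(M₀)} (weight)`; by ★ B10 PART 1 the sum splits over the axis strata `stratum σ ϖ T a`;
★ B3-γ leaves eight shapes; THIS FILE does the four SPLIT shapes — core `(0,0,0)` and on-branch `(0,s,s)`, `(s,0,s)`, `(s,s,0)` — for ANY diagonal token `diag(e)·M ⊆ ϖ^ℓ·M`: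
the token is constant on each of them (★ p859056's HNF read at the four normal forms), so the label-cut weight sum is ★ B4's value behind an indicator.  The glued and
core-hanging shapes (G1–G3, H), where the token reads the glue residue, are NOT here.

THE MATHEMATICS ([Serre1980Trees, II §1.1]; [Kottwitz1986BaseChangeUnits, §1]; [Rogawski1990, §4.9]).  ★ B4 identifies the four split strata with the normal forms `𝒪³`,
`latt[[1,0,0],[0,1,0],[0,z,ϖ^s]]`, `latt[[1,0,0],[0,1,0],[y,0,ϖ^s]]`, `latt[[1,0,0],[x,ϖ^s,0],[0,0,1]]` (`x, y, z` units); ★ p859056 `latticeInLevel_diagonal_latt_hnf_iff` reads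
`diag(e)·M ⊆ ϖ^ℓ·M` on `latt[[1,0,0],[x,p,0],[y,z,r]]` as six valuation inequalities, which at these forms collapse to
  core: `|e_i| ≤ |ϖ|^ℓ` (i = 0,1,2);   T1 `(0,s,s)`: `|e_i| ≤ |ϖ|^ℓ ∧ |e₂ − e₁| ≤ |ϖ|^{ℓ+s}`;   T2 `(s,0,s)`: `… ∧ |e₂ − e₀| ≤ |ϖ|^{ℓ+s}`;   T3 `(s,s,0)`: `… ∧ |e₁ − e₀| ≤ |ϖ|^{ℓ+s}`
— independent of the unit `x ∕ y ∕ z`.  Hence (§2, `finsum_mem_sep_eq_ite_of_forall_iff`) `Σᶠ_{M ∈ stratum a, token(M)} w(M) = [P_a(e, ℓ)] · Σᶠ_{M ∈ stratum a} w(M)`, and ★ B4's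
sockets give the values (§3): e.g. `Σᶠ_{M ∈ stratum (0,s,s), diag(e)M ⊆ ϖ^ℓM} 1∕[𝒰 : S_F(M)] = q^{s∕2}` if `2 ∣ s ∧ s ≤ n₁ ∧ (∀ i, |e_i| ≤ |ϖ|^ℓ) ∧ |e₂ − e₁| ≤ |ϖ|^{ℓ+s}`, else `0`.
For the operators of record `e = (α−1, β−1, 0)` (`|e₂ − e₁| = |β − 1| = |ϖ|^{n₁}`) the T1 condition is `s + ℓ ≤ n₁` — the unit condition `s ≤ n₁` at the SHIFTED depth `n₁ − ℓ`,
which is F0P3a-p01 (g35) (F2)∕(F3)'s «unit law at shifted exponents» seen stratum by stratum (for `e = ((α−1)², (β−1)², 0)`: `s + ℓ ≤ 2n₁`).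
* §1 `latticeInLevel_diagonal_stdLattice_iff`, `latticeInLevel_diagonal_latt_T1_iff`, `…_T2_iff`, `…_T3_iff` (token reads at the four normal forms; generic valued field;
  constancy on the strata follows through ★ B4's `hasAxis_axis{1,2,3}_iff` inside §3).
* §2 `finsum_mem_sep_eq_ite_of_forall_iff` (a constant label factors out as an indicator).
* §3 HEADS `finsum_stabiliserWeight_stratum_{core,T1,T2,T3}_sep_latticeInLevel` (the four labelled split tables over ★ B4).
HONEST LABEL.  Count-neutral (`--supports`); the four easy eighths of a labelled Stage-B table, nothing printed is asserted; pays NO tier-0 row; the glued ∕ core-hanging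
strata and every law remain PROVER TARGETS; `HC_CM` is proved only modulo the 7 printed citations (2 remaining named inputs: hLiu418 = `stmt-HodgeConjecture-24832`, h413 =
`stmt-HodgeConjecture-24833`) until rung 0 closes.

## References
* [Serre1980Trees] J.-P. Serre, *Trees*, Springer (1980), Ch. II §1.1 (lattices, Hermite normal forms, the apartment of the diagonal torus).
* [Kottwitz1986BaseChangeUnits] R. E. Kottwitz, *Base change for unit elements of Hecke algebras*, Compositio Math. 60 (1986), §1 pp. 240–241 (lattice counts modulo the torus).
* [Rogawski1990] J. D. Rogawski, *Automorphic Representations of Unitary Groups in Three Variables*, Ann. of Math. Stud. 123 (1990), §4.9 Prop. 4.9.1 (a)(b) p. 55.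
-/

set_option autoImplicit false

noncomputable section

namespace Summit.HodgeConjecture.HodgeConjecture.Cruxes.H413.F0P3cDyRamLabelledSplitStrata

open Literature.NumberTheory.Automorphic Literature.NumberTheory.Automorphic.HermitianLattice
open Literature.NumberTheory.Automorphic.UnitaryLatticeTree Literature.NumberTheory.Automorphic.UnitaryThreeFourFrame
open Summit.HodgeConjecture.HodgeConjecture.Cruxes.H413.F0P3cDyRamDiagonalTorusDefs
open Summit.HodgeConjecture.HodgeConjecture.Cruxes.H413.F0P3cDyRamDiagonalStrataDefs
open Summit.HodgeConjecture.HodgeConjecture.Cruxes.H413.F0P3cDyRamDiagonalSplitCountSockets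
open Summit.HodgeConjecture.HodgeConjecture.Cruxes.H413.F0P3cDyRamFourFrameCensusDefs
open Summit.HodgeConjecture.HodgeConjecture.Cruxes.H413.F0P3cDyRamLevelTokenHNF
open scoped Valued WithZero Matrix MatrixGroups

/-! ## §1  The diagonal level token at the four split normal forms, and its constancy on the split strata -/

section Forms

variable {K : Type*} [Field K] [Valued K ℤᵐ⁰]

/-- **CORE**: `diag(e)·𝒪³ ⊆ ϖ^ℓ·𝒪³ ↔ |e_i| ≤ |ϖ|^ℓ` for `i = 0, 1, 2`. [cite: Serre1980Trees, II §1.1] -/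
theorem latticeInLevel_diagonal_stdLattice_iff {ϖ : K} (hϖ : ϖ ≠ 0) (ℓ : ℕ) (e : Fin 3 → K) :
    LatticeInLevel ϖ ℓ (Matrix.diagonal e) (stdLattice K 3) ↔
      Valued.v (e 0) ≤ Valued.v ϖ ^ ℓ ∧ Valued.v (e 1) ≤ Valued.v ϖ ^ ℓ ∧ Valued.v (e 2) ≤ Valued.v ϖ ^ ℓ := by
  have hform : stdLattice K 3 = latt (Matrix.of ![![1, 0, 0], ![(0 : K), ϖ ^ 0, 0], ![(0 : K), 0, ϖ ^ 0]]) := by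
    rw [← latt_one, pow_zero]
    congr 1
    ext i j; fin_cases i <;> fin_cases j <;> rfl
  rw [hform, latticeInLevel_diagonal_latt_hnf_pow_iff hϖ ℓ 0 0 e 0 0 0]
  simp

/-- **T1 `(0,s,s)`**: on `latt[[1,0,0],[0,1,0],[0,z,ϖ^s]]` with `|z| = 1`: `diag(e)·M ⊆ ϖ^ℓ·M ↔ (∀ i, |e_i| ≤ |ϖ|^ℓ) ∧ |e₂ − e₁| ≤ |ϖ|^{ℓ+s}`.
[cite: Serre1980Trees, II §1.1] [cite: Kottwitz1986BaseChangeUnits, §1 pp. 240–241] -/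
theorem latticeInLevel_diagonal_latt_T1_iff {ϖ : K} (hϖ : ϖ ≠ 0) (ℓ s : ℕ) (e : Fin 3 → K) {z : K} (hz : Valued.v z = 1) :
    LatticeInLevel ϖ ℓ (Matrix.diagonal e) (latt (!![1, 0, 0; 0, 1, 0; 0, z, ϖ ^ s] : Matrix (Fin 3) (Fin 3) K)) ↔
      (Valued.v (e 0) ≤ Valued.v ϖ ^ ℓ ∧ Valued.v (e 1) ≤ Valued.v ϖ ^ ℓ ∧ Valued.v (e 2) ≤ Valued.v ϖ ^ ℓ) ∧
        Valued.v (e 2 - e 1) ≤ Valued.v ϖ ^ (ℓ + s) := by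
  have hform : (!![1, 0, 0; 0, 1, 0; 0, z, ϖ ^ s] : Matrix (Fin 3) (Fin 3) K) = Matrix.of ![![1, 0, 0], ![(0 : K), ϖ ^ 0, 0], ![(0 : K), z, ϖ ^ s]] := by
    rw [pow_zero]
  rw [hform, latticeInLevel_diagonal_latt_hnf_pow_iff hϖ ℓ 0 s e 0 0 z]
  simp [hz, and_assoc]

/-- **T2 `(s,0,s)`**: on `latt[[1,0,0],[0,1,0],[y,0,ϖ^s]]` with `|y| = 1`: `diag(e)·M ⊆ ϖ^ℓ·M ↔ (∀ i, |e_i| ≤ |ϖ|^ℓ) ∧ |e₂ − e₀| ≤ |ϖ|^{ℓ+s}`.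
[cite: Serre1980Trees, II §1.1] [cite: Kottwitz1986BaseChangeUnits, §1 pp. 240–241] -/
theorem latticeInLevel_diagonal_latt_T2_iff {ϖ : K} (hϖ : ϖ ≠ 0) (ℓ s : ℕ) (e : Fin 3 → K) {y : K} (hy : Valued.v y = 1) :
    LatticeInLevel ϖ ℓ (Matrix.diagonal e) (latt (!![1, 0, 0; 0, 1, 0; y, 0, ϖ ^ s] : Matrix (Fin 3) (Fin 3) K)) ↔
      (Valued.v (e 0) ≤ Valued.v ϖ ^ ℓ ∧ Valued.v (e 1) ≤ Valued.v ϖ ^ ℓ ∧ Valued.v (e 2) ≤ Valued.v ϖ ^ ℓ) ∧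
        Valued.v (e 2 - e 0) ≤ Valued.v ϖ ^ (ℓ + s) := by
  have hform : (!![1, 0, 0; 0, 1, 0; y, 0, ϖ ^ s] : Matrix (Fin 3) (Fin 3) K) = Matrix.of ![![1, 0, 0], ![(0 : K), ϖ ^ 0, 0], ![y, 0, ϖ ^ s]] := by
    rw [pow_zero]
  rw [hform, latticeInLevel_diagonal_latt_hnf_pow_iff hϖ ℓ 0 s e 0 y 0]
  simp [hy, and_assoc]

/-- **T3 `(s,s,0)`**: on `latt[[1,0,0],[x,ϖ^s,0],[0,0,1]]` with `|x| = 1`: `diag(e)·M ⊆ ϖ^ℓ·M ↔ (∀ i, |e_i| ≤ |ϖ|^ℓ) ∧ |e₁ − e₀| ≤ |ϖ|^{ℓ+s}`.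
[cite: Serre1980Trees, II §1.1] [cite: Kottwitz1986BaseChangeUnits, §1 pp. 240–241] -/
theorem latticeInLevel_diagonal_latt_T3_iff {ϖ : K} (hϖ : ϖ ≠ 0) (ℓ s : ℕ) (e : Fin 3 → K) {x : K} (hx : Valued.v x = 1) :
    LatticeInLevel ϖ ℓ (Matrix.diagonal e) (latt (!![1, 0, 0; x, ϖ ^ s, 0; 0, 0, 1] : Matrix (Fin 3) (Fin 3) K)) ↔
      (Valued.v (e 0) ≤ Valued.v ϖ ^ ℓ ∧ Valued.v (e 1) ≤ Valued.v ϖ ^ ℓ ∧ Valued.v (e 2) ≤ Valued.v ϖ ^ ℓ) ∧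
        Valued.v (e 1 - e 0) ≤ Valued.v ϖ ^ (ℓ + s) := by
  have hform : (!![1, 0, 0; x, ϖ ^ s, 0; 0, 0, 1] : Matrix (Fin 3) (Fin 3) K) = Matrix.of ![![1, 0, 0], ![x, ϖ ^ s, 0], ![(0 : K), 0, ϖ ^ 0]] := by
    rw [pow_zero]
  rw [hform, latticeInLevel_diagonal_latt_hnf_pow_iff hϖ ℓ s 0 e x 0 0]
  simp [hx, and_assoc]

end Forms

/-! ## §2  A label that is constant on a set factors out of the label-cut sum as an indicator -/

section Sep

variable {K : Type*} [Field K] [Valued K ℤᵐ⁰]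

/-- If `Q ↔ P` on all of `S`, then `Σᶠ_{M ∈ S, Q M} w(M) = [P]·Σᶠ_{M ∈ S} w(M)`. [cite: Serre1980Trees, II §1.1] -/
theorem finsum_mem_sep_eq_ite_of_forall_iff {α : Type*} (S : Set α) (Q : α → Prop) (P : Prop) [Decidable P] (hQ : ∀ a ∈ S, Q a ↔ P)
    (w : α → ℚ) : ∑ᶠ a ∈ {a | a ∈ S ∧ Q a}, w a = if P then ∑ᶠ a ∈ S, w a else 0 := by
  split_ifs with hP
  · have hset : {a | a ∈ S ∧ Q a} = S := Set.ext fun a => ⟨fun h => h.1, fun h => ⟨h, (hQ a h).2 hP⟩⟩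
    rw [hset]
  · have hset : {a | a ∈ S ∧ Q a} = ∅ := Set.eq_empty_of_forall_notMem fun a h => hP ((hQ a h.1).1 h.2)
    rw [hset, finsum_mem_empty]

end Sep

/-! ## §3  The four labelled split tables over ★ B4 -/

section Tables

variable {K : Type} [Field K] [Valued K ℤᵐ⁰] [Fintype 𝓀[K]] {σ : K →+* K} {ϖ : K} {d t : ℕ} {α β : K} {N₀ n₁ n₂ n₃ : ℕ} {T : GL (Fin 3) K}

omit [Fintype 𝓀[K]] in
/-- **LABELLED CORE**: `Σᶠ_{M ∈ stratum (0,0,0), diag(e)M ⊆ ϖ^ℓM} 1∕[𝒰 : S_F(M)] = 1` if `|e_i| ≤ |ϖ|^ℓ` (`i = 0,1,2`), else `0` (the stratum is `{𝒪³}`, ★ `finsum_stabiliserWeight_hasAxis_core`).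
[cite: Rogawski1990, §4.9 Prop. 4.9.1 (a) p. 55] [cite: Kottwitz1986BaseChangeUnits, §1 pp. 240–241] -/
theorem finsum_stabiliserWeight_stratum_core_sep_latticeInLevel (hD : IsRamifiedQuadraticDatum σ ϖ d t) (hE : IsElementDatum σ ϖ N₀ α β n₁ n₂ n₃)
    (hT : (T : Matrix (Fin 3) (Fin 3) K) = Matrix.diagonal ![α, β, 1]) (ℓ : ℕ) (e : Fin 3 → K) :
    ∑ᶠ M ∈ {M | M ∈ stratum σ ϖ T ![0, 0, 0] ∧ LatticeInLevel ϖ ℓ (Matrix.diagonal e) M}, stabiliserWeight σ M =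
      if Valued.v (e 0) ≤ Valued.v ϖ ^ ℓ ∧ Valued.v (e 1) ≤ Valued.v ϖ ^ ℓ ∧ Valued.v (e 2) ≤ Valued.v ϖ ^ ℓ then 1 else 0 := by
  classical
  have hϖ : Valued.v ϖ = WithZero.exp (-1 : ℤ) := hD.2.2.1
  have hϖ0 : ϖ ≠ 0 := fun h0 => by rw [h0, map_zero] at hϖ; exact WithZero.coe_ne_zero hϖ.symm
  -- every member of the core stratum is `𝒪³` (all `eᵢ ∈ M ≤ 𝒪³`)
  have hmem : ∀ M ∈ stratum σ ϖ T ![0, 0, 0], M = stdLattice K 3 := by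
    rintro M ⟨⟨-, -, hN⟩, -, hax⟩
    refine le_antisymm (fun w hw => mem_stdLattice.2 fun j => (hN j).1 w hw) (fun w hw => ?_)
    have hw' : ∀ j, Valued.v (w j) ≤ 1 := fun j => mem_stdLattice.1 hw j
    rw [← Finset.univ_sum_single w]
    refine M.sum_mem fun i _ => ?_
    have e0 : ((![0, 0, 0] : Fin 3 → ℕ) i) = 0 := by fin_cases i <;> rfl
    have hi : (Pi.single i (w i) : Fin 3 → K) ∈ M := (hax i (w i)).2 (by rw [e0, pow_zero]; exact hw' i)
    exact hi
  rw [finsum_mem_sep_eq_ite_of_forall_iff (stratum σ ϖ T ![0, 0, 0]) _ _ (fun M hM => by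
    rw [hmem M hM, latticeInLevel_diagonal_stdLattice_iff hϖ0 ℓ e]), finsum_stabiliserWeight_hasAxis_core hD hE hT]

/-- **LABELLED T1 `(0,s,s)`** (`s ≥ 1`): `Σᶠ_{M ∈ stratum (0,s,s), diag(e)M ⊆ ϖ^ℓM} 1∕[𝒰 : S_F(M)] = q^{s∕2}` if `2 ∣ s ∧ s ≤ n₁` AND `(∀ i, |e_i| ≤ |ϖ|^ℓ) ∧ |e₂ − e₁| ≤ |ϖ|^{ℓ+s}`,
else `0` (★ `finsum_stabiliserWeight_hasAxis_T1` behind the constant label of §1).  At `e = (α−1, β−1, 0)`: `|e₂ − e₁| = |ϖ|^{n₁}`, so the label asks `s + ℓ ≤ n₁` — the unit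
condition at the shifted depth. [cite: Rogawski1990, §4.9 Prop. 4.9.1 (a) p. 55] [cite: Kottwitz1986BaseChangeUnits, §1 pp. 240–241] -/
theorem finsum_stabiliserWeight_stratum_T1_sep_latticeInLevel (hD : IsRamifiedQuadraticDatum σ ϖ d t) (hE : IsElementDatum σ ϖ N₀ α β n₁ n₂ n₃)
    (hT : (T : Matrix (Fin 3) (Fin 3) K) = Matrix.diagonal ![α, β, 1]) (s : ℕ) (hs : 1 ≤ s) (ℓ : ℕ) (e : Fin 3 → K) :
    ∑ᶠ M ∈ {M | M ∈ stratum σ ϖ T ![0, s, s] ∧ LatticeInLevel ϖ ℓ (Matrix.diagonal e) M}, stabiliserWeight σ M =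
      if ((Valued.v (e 0) ≤ Valued.v ϖ ^ ℓ ∧ Valued.v (e 1) ≤ Valued.v ϖ ^ ℓ ∧ Valued.v (e 2) ≤ Valued.v ϖ ^ ℓ) ∧
          Valued.v (e 2 - e 1) ≤ Valued.v ϖ ^ (ℓ + s)) then
        (if 2 ∣ s ∧ s ≤ n₁ then ((Fintype.card 𝓀[K] : ℚ) ^ (s / 2)) else 0) else 0 := by
  classical
  have hϖ : Valued.v ϖ = WithZero.exp (-1 : ℤ) := hD.2.2.1
  have hϖ0 : ϖ ≠ 0 := fun h0 => by rw [h0, map_zero] at hϖ; exact WithZero.coe_ne_zero hϖ.symm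
  rw [finsum_mem_sep_eq_ite_of_forall_iff (stratum σ ϖ T ![0, s, s]) _ _ (fun M hM => by
    obtain ⟨z, hz, rfl⟩ := (hasAxis_axis1_iff hϖ hM.1 hs).1 hM.2.2
    exact latticeInLevel_diagonal_latt_T1_iff hϖ0 ℓ s e hz), finsum_stabiliserWeight_hasAxis_T1 hD hE hT s hs]

/-- **LABELLED T2 `(s,0,s)`** (`s ≥ 1`): `q^{s∕2}` if `2 ∣ s ∧ s ≤ n₂` AND `(∀ i, |e_i| ≤ |ϖ|^ℓ) ∧ |e₂ − e₀| ≤ |ϖ|^{ℓ+s}`, else `0` (★ `finsum_stabiliserWeight_hasAxis_T2`).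
[cite: Rogawski1990, §4.9 Prop. 4.9.1 (a) p. 55] [cite: Kottwitz1986BaseChangeUnits, §1 pp. 240–241] -/
theorem finsum_stabiliserWeight_stratum_T2_sep_latticeInLevel (hD : IsRamifiedQuadraticDatum σ ϖ d t) (hE : IsElementDatum σ ϖ N₀ α β n₁ n₂ n₃)
    (hT : (T : Matrix (Fin 3) (Fin 3) K) = Matrix.diagonal ![α, β, 1]) (s : ℕ) (hs : 1 ≤ s) (ℓ : ℕ) (e : Fin 3 → K) :
    ∑ᶠ M ∈ {M | M ∈ stratum σ ϖ T ![s, 0, s] ∧ LatticeInLevel ϖ ℓ (Matrix.diagonal e) M}, stabiliserWeight σ M =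
      if ((Valued.v (e 0) ≤ Valued.v ϖ ^ ℓ ∧ Valued.v (e 1) ≤ Valued.v ϖ ^ ℓ ∧ Valued.v (e 2) ≤ Valued.v ϖ ^ ℓ) ∧
          Valued.v (e 2 - e 0) ≤ Valued.v ϖ ^ (ℓ + s)) then
        (if 2 ∣ s ∧ s ≤ n₂ then ((Fintype.card 𝓀[K] : ℚ) ^ (s / 2)) else 0) else 0 := by
  classical
  have hϖ : Valued.v ϖ = WithZero.exp (-1 : ℤ) := hD.2.2.1
  have hϖ0 : ϖ ≠ 0 := fun h0 => by rw [h0, map_zero] at hϖ; exact WithZero.coe_ne_zero hϖ.symm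
  rw [finsum_mem_sep_eq_ite_of_forall_iff (stratum σ ϖ T ![s, 0, s]) _ _ (fun M hM => by
    obtain ⟨y, hy, rfl⟩ := (hasAxis_axis2_iff hϖ hM.1 hs).1 hM.2.2
    exact latticeInLevel_diagonal_latt_T2_iff hϖ0 ℓ s e hy), finsum_stabiliserWeight_hasAxis_T2 hD hE hT s hs]

/-- **LABELLED T3 `(s,s,0)`** (`s ≥ 1`): `q^{s∕2}` if `2 ∣ s ∧ s ≤ n₃` AND `(∀ i, |e_i| ≤ |ϖ|^ℓ) ∧ |e₁ − e₀| ≤ |ϖ|^{ℓ+s}`, else `0` (★ `finsum_stabiliserWeight_hasAxis_T3`).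
[cite: Rogawski1990, §4.9 Prop. 4.9.1 (a) p. 55] [cite: Kottwitz1986BaseChangeUnits, §1 pp. 240–241] -/
theorem finsum_stabiliserWeight_stratum_T3_sep_latticeInLevel (hD : IsRamifiedQuadraticDatum σ ϖ d t) (hE : IsElementDatum σ ϖ N₀ α β n₁ n₂ n₃)
    (hT : (T : Matrix (Fin 3) (Fin 3) K) = Matrix.diagonal ![α, β, 1]) (s : ℕ) (hs : 1 ≤ s) (ℓ : ℕ) (e : Fin 3 → K) :
    ∑ᶠ M ∈ {M | M ∈ stratum σ ϖ T ![s, s, 0] ∧ LatticeInLevel ϖ ℓ (Matrix.diagonal e) M}, stabiliserWeight σ M =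
      if ((Valued.v (e 0) ≤ Valued.v ϖ ^ ℓ ∧ Valued.v (e 1) ≤ Valued.v ϖ ^ ℓ ∧ Valued.v (e 2) ≤ Valued.v ϖ ^ ℓ) ∧
          Valued.v (e 1 - e 0) ≤ Valued.v ϖ ^ (ℓ + s)) then
        (if 2 ∣ s ∧ s ≤ n₃ then ((Fintype.card 𝓀[K] : ℚ) ^ (s / 2)) else 0) else 0 := by
  classical
  have hϖ : Valued.v ϖ = WithZero.exp (-1 : ℤ) := hD.2.2.1
  have hϖ0 : ϖ ≠ 0 := fun h0 => by rw [h0, map_zero] at hϖ; exact WithZero.coe_ne_zero hϖ.symm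
  rw [finsum_mem_sep_eq_ite_of_forall_iff (stratum σ ϖ T ![s, s, 0]) _ _ (fun M hM => by
    obtain ⟨x, hx, rfl⟩ := (hasAxis_axis3_iff hϖ hM.1 hs).1 hM.2.2
    exact latticeInLevel_diagonal_latt_T3_iff hϖ0 ℓ s e hx), finsum_stabiliserWeight_hasAxis_T3 hD hE hT s hs]

end Tables

end Summit.HodgeConjecture.HodgeConjecture.Cruxes.H413.F0P3cDyRamLabelledSplitStrata

end
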